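import Literature.NumberTheory.LFunctions.VerjovskyTheoremAProofs
import Literature.NumberTheory.LFunctions.HorocycleRHProofs
import HarnessLib

/-!
RH-FREE (the proved statements are implications «rate of Verjovsky's measures ⟹ zero-free
half-plane»; nothing here bears on the truth of RH). # Verjovsky 1994, Theorem B — the
sufficiency halves, PROVED

For the named facts `Verjovsky1994_thmB1` / `Verjovsky1994_thmB2`
(`Literature/NumberTheory/LFunctions/VerjovskyDiscreteMeasures.lean`; Kodai Math. J. 17 (1994),
Thm B p. 597) we prove the directions «bound on `m_y(f) − m₀(f)` for all `f ∈ C_c²(ℝ₊ˣ)` ⟹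
zeros of `ζ`»:

* `Literature.NumberTheory.LFunctions.VerjovskyCriterion.riemannZeta_ne_zero_of_verjovskyRate_of_class`
  — for ANY smoothness class `C_c^r(ℝ₊ˣ)` (`r : ℕ`; Verjovsky works with `C_c^r`, `r ≥ 2`): if
  `0 < α ≤ 1` and `m_y(f) − m₀(f) = O(y^{α−ε})` at `0⁺` for every `f ∈ C_c^r(ℝ₊ˣ)` and every
  `ε > 0`, then `ζ(s) ≠ 0` for `re s > 2(1 − α)` (Thm B 2), first half, p. 604 — the test
  function used is a `C^∞` bump, so the class does not matter);
* `Literature.NumberTheory.LFunctions.VerjovskyCriterion.riemannZeta_ne_zero_of_verjovskyRate` —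
  the case `r = 2` of the fact's binders;
* `Literature.NumberTheory.LFunctions.Verjovsky1994_thmB2.mpr_holds` — the same in the binders
  of the fact (`1/2 < α < 3/4`);
* `Literature.NumberTheory.LFunctions.Verjovsky1994_thmB1.mpr_holds` — `m_y(f) − m₀(f) =
  o(y^{3/4−ε})` for all `f ∈ C_c²`, all `ε > 0` ⟹ RH (Thm B 1), sufficiency).

## The printed proof and the road taken here

Verjovsky (§2, pp. 599–604) computes the Mellin transform of `y ↦ m_y(f)`:
`∫₀^∞ m_y(f) y^{s−1} dy = 2 f̃(2s+2) Σ_n φ(n) n^{−2s−2} = 2 f̃(2s+2) ζ(2s+1)/ζ(2s+2)`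
(`re s > 0`, `f̃` the Mellin transform of `f`), and argues: a rate `O(y^{α−ε})` makes the Mellin
transform of `m_y(f) − m₀(f)` (cut off where `m_y(f)` vanishes) holomorphic on `re s > −α`, so
`f̃(2s+2) ζ(2s+1)/ζ(2s+2)` continues there, and a zero `ρ` of `ζ` with `re ρ > 2(1−α)` at
`2s+2 = ρ` would force `f̃(ρ) ζ(ρ−1) = 0`, impossible for a suitable bump `f`. This is exactly the
architecture of the tree's PROVED Zagier criterion for closed horocycles
(`Literature/NumberTheory/LFunctions/HorocycleRHProofs.lean`, `quasiRH_of_horocycleRate_holds`),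
whose tools we reuse verbatim: the bump with `f̃(ρ) ≠ 0` (`exists_bump`), the entire function
`zetaReg w = (w−1)ζ(w)` used to clear the poles so that the identity theorem runs on the convex
half-plane `re s > −α`, `L(φ,w)ζ(w) = ζ(w−1)` (`LSeries_totient_mul_zeta`), the Mellin transform
of an indicator (`hasMellin_indicator`), and «only trivial zeros in `re s ≤ 0`»
(`riemannZeta_eq_zero_iff_of_re_nonpos`). New here (§1 of this file): the Mellin transform of
one row `y ↦ y φ(n) f(n√y)` (`mellin_row`, Mathlib's `mellin_comp_rpow`/`mellin_comp_mul_left`/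
`mellin_cpow_smul`), the interchange of `Σ_n` and `∫ dy` by absolute convergence
(`mellin_verjovskyMeasure`), continuity and eventual vanishing of `y ↦ m_y(f)`.

## References

* A. Verjovsky, *Discrete measures and the Riemann hypothesis*, Kodai Math. J. 17 (1994)
  596–608, Thm B p. 597, proof §2–§3 pp. 599–604 [Verjovsky1994].
* D. Zagier, *Eisenstein series and the Riemann zeta function* (1981), §1 pp. 279–280 (the
  model argument) [Zagier1981].

## Mathlib / tree search

Tree: `HorocycleRHProofs` (`exists_bump`, `zetaReg`, `differentiable_zetaReg`,
`LSeries_totient_mul_zeta`, `hasMellin_indicator`, `mellinConvergent_bump`,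
`differentiable_mellin_bump`), `GeneralizedRH` (`riemannZeta_eq_zero_iff_of_re_nonpos`,
`quasiRiemannHypothesis_one_half_iff_holds`, `QuasiRiemannHypothesis`),
`VerjovskyTheoremAProofs` (`VerjovskyTheoremA.verjovskyMeasure_eq_mul_sum`). Mathlib: `mellin`,
`mellin_differentiableAt_of_isBigO_rpow`, `mellinConvergent_of_isBigO_rpow`,
`hasSum_integral_of_summable_integral_norm`, `riemannZeta_ne_zero_of_one_le_re`.
-/

noncomputable section

open Real Complex MeasureTheory Set Filter Asymptotics Topology

namespace Literature.NumberTheory.LFunctions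

namespace VerjovskyCriterion

variable {ψ : ℝ → ℝ} {a b : ℝ}

/-! ### §1. The rows `y ↦ y φ(n) ψ(n √y)` and their Mellin transforms -/

/-- The `n`-th row of `m_y`: `y φ(n+1) ψ((n+1)√y)` (indexing from `0` as in `verjovskyMeasure`).
[cite: Verjovsky1994, §1 eq. (1)] -/
def row (ψ : ℝ → ℝ) (n : ℕ) (y : ℝ) : ℝ :=
  y * ((n + 1).totient : ℝ) * ψ (Real.sqrt y * (n + 1))

/-- `m_y(ψ) = Σ_n row ψ n y`. [cite: Verjovsky1994, §1 eq. (1)] -/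
theorem verjovskyMeasure_eq_tsum_row (ψ : ℝ → ℝ) (y : ℝ) :
    verjovskyMeasure y (fun u ↦ (ψ u : ℂ)) = ∑' n : ℕ, (row ψ n y : ℂ) := by
  unfold verjovskyMeasure row
  refine tsum_congr fun n ↦ ?_
  push_cast
  ring

/-- Continuity of a row. [cite: Verjovsky1994, §1 (m_y ∈ dual of C_c^r)] -/
theorem continuous_row (hψc : Continuous ψ) (n : ℕ) : Continuous (row ψ n) :=
  ((continuous_id.mul continuous_const)).mul
    (hψc.comp ((Real.continuous_sqrt).mul continuous_const))

/-- Support of a row from below: `row ψ n y ≠ 0 ⟹ (a/(n+1))² ≤ y`.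
[cite: Verjovsky1994, §1 (support of f ⊂ ℝ*)] -/
theorem sq_le_of_row_ne_zero (ha : 0 < a) (hψa : ∀ t, ψ t ≠ 0 → a ≤ t) {n : ℕ} {y : ℝ}
    (hy : row ψ n y ≠ 0) : (a / (n + 1)) ^ 2 ≤ y := by
  have hψ : ψ (Real.sqrt y * (n + 1)) ≠ 0 := fun h ↦ hy (by simp [row, h])
  have h1 : a ≤ Real.sqrt y * (n + 1) := hψa _ hψ
  have hn : (0 : ℝ) < n + 1 := by positivity
  have h2 : a / (n + 1) ≤ Real.sqrt y := by rwa [div_le_iff₀ hn]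
  have h3 : 0 < Real.sqrt y := lt_of_lt_of_le (by positivity) h2
  have hy0 : 0 ≤ y := le_of_lt (Real.sqrt_pos.1 h3)
  calc (a / (n + 1)) ^ 2 ≤ Real.sqrt y ^ 2 := by gcongr
    _ = y := Real.sq_sqrt hy0

/-- Support of a row from above: `row ψ n y ≠ 0 ⟹ y ≤ (max a b/(n+1))²`.
[cite: Verjovsky1994, §1 (support of f compact)] -/
theorem le_sq_of_row_ne_zero (ha : 0 < a) (hψa : ∀ t, ψ t ≠ 0 → a ≤ t)
    (hψb : ∀ t, ψ t ≠ 0 → t ≤ b) {n : ℕ} {y : ℝ} (hy : row ψ n y ≠ 0) :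
    y ≤ (max a b / (n + 1)) ^ 2 := by
  have hψ : ψ (Real.sqrt y * (n + 1)) ≠ 0 := fun h ↦ hy (by simp [row, h])
  have h1 : Real.sqrt y * (n + 1) ≤ b := hψb _ hψ
  have hn : (0 : ℝ) < n + 1 := by positivity
  have h2 : Real.sqrt y ≤ max a b / (n + 1) := by
    rw [le_div_iff₀ hn]; exact h1.trans (le_max_right _ _)
  have hy0 : 0 ≤ y := le_of_lt (Real.sqrt_pos.1 (lt_of_lt_of_le (by positivity)
    ((div_le_iff₀ hn).2 (hψa _ hψ))))
  calc y = Real.sqrt y ^ 2 := (Real.sq_sqrt hy0).symm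
    _ ≤ (max a b / (n + 1)) ^ 2 := by gcongr

/-- **Mellin transform of one row** (substitutions `y = u²`, `u ↦ u/(n+1)`):
`∫₀^∞ y^{s−1} · y φ(n+1) χ((n+1)√y) dy = φ(n+1) · 2 (n+1)^{−(2s+2)} χ̃(2s+2)` — an identity of
(possibly divergent, then zero by convention) Mellin integrals.
[cite: Verjovsky1994, §2 (Mellin transform of m_y)] -/
theorem mellin_row (χ : ℝ → ℝ) (n : ℕ) (s : ℂ) :
    mellin (fun y ↦ (row χ n y : ℂ)) s =
      ((n + 1).totient : ℂ) * (2 * ((n : ℂ) + 1) ^ (-(2 * s + 2)) *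
        mellin (fun v ↦ (χ v : ℂ)) (2 * s + 2)) := by
  have hn : (0 : ℝ) < (n : ℝ) + 1 := by positivity
  set K : ℝ → ℂ := fun t ↦ (χ (((n : ℝ) + 1) * t) : ℂ) with hK
  have h1 : mellin (fun y ↦ (row χ n y : ℂ)) s =
      mellin (fun y ↦ ((n + 1).totient : ℂ) • ((y : ℂ) ^ (1 : ℂ) • K (y ^ (1 / 2 : ℝ)))) s := by
    unfold mellin
    refine setIntegral_congr_fun measurableSet_Ioi fun y hy ↦ ?_
    simp only [row, hK, smul_eq_mul, cpow_one, ← Real.sqrt_eq_rpow]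
    push_cast
    ring
  rw [h1, mellin_const_smul, mellin_cpow_smul, mellin_comp_rpow]
  have h2 : mellin K ((s + 1) / ((1 / 2 : ℝ) : ℂ)) =
      ((((n : ℝ) + 1 : ℝ)) : ℂ) ^ (-((s + 1) / ((1 / 2 : ℝ) : ℂ))) •
        mellin (fun v ↦ (χ v : ℂ)) ((s + 1) / ((1 / 2 : ℝ) : ℂ)) :=
    mellin_comp_mul_left (fun v : ℝ ↦ (χ v : ℂ)) _ hn
  rw [h2]
  have e : (s + 1) / ((1 / 2 : ℝ) : ℂ) = 2 * s + 2 := by push_cast; ring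
  rw [e, show |(1 / 2 : ℝ)|⁻¹ = (2 : ℝ) by norm_num]
  simp only [smul_eq_mul, Complex.real_smul]
  push_cast
  ring

/-- A real-valued version of the Mellin integral at a real point: for `y > 0` the integrand
`y^{σ−1} χ(y)` is real. [cite: Verjovsky1994, §2 (absolute convergence)] -/
theorem mellin_ofReal_eq (χ : ℝ → ℝ) (σ : ℝ) :
    mellin (fun y ↦ (χ y : ℂ)) (σ : ℂ) = ((∫ y in Ioi (0 : ℝ), y ^ (σ - 1) * χ y : ℝ) : ℂ) := by
  unfold mellin
  rw [← integral_complex_ofReal]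
  refine setIntegral_congr_fun measurableSet_Ioi fun y hy ↦ ?_
  have : ((σ : ℂ) - 1) = ((σ - 1 : ℝ) : ℂ) := by push_cast; ring
  rw [smul_eq_mul, this, ← ofReal_cpow (le_of_lt hy)]
  push_cast
  ring

/-- The `L¹` norm of a row against `y^{s−1}`:
`∫₀^∞ ‖y^{s−1} row ψ n y‖ dy = 2 φ(n+1) (n+1)^{−(2σ+2)} ∫₀^∞ v^{2σ+1} |ψ(v)| dv`, `σ = re s`.
[cite: Verjovsky1994, §2 (absolute convergence of the Mellin transform for re s > 0)] -/
theorem integral_norm_row (ψ : ℝ → ℝ) (n : ℕ) (s : ℂ) :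
    ∫ y in Ioi (0 : ℝ), ‖(y : ℂ) ^ (s - 1) • (row ψ n y : ℂ)‖ =
      ((n + 1).totient : ℝ) * (2 * ((n : ℝ) + 1) ^ (-(2 * s.re + 2)) *
        ∫ v in Ioi (0 : ℝ), v ^ (2 * s.re + 2 - 1) * |ψ v|) := by
  -- the integrand is `y^{re s - 1} · row |ψ| n y`
  have h1 : ∫ y in Ioi (0 : ℝ), ‖(y : ℂ) ^ (s - 1) • (row ψ n y : ℂ)‖ =
      ∫ y in Ioi (0 : ℝ), y ^ (s.re - 1) * row (fun v ↦ |ψ v|) n y := by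
    refine setIntegral_congr_fun measurableSet_Ioi fun y hy ↦ ?_
    have hy' : 0 < y := hy
    rw [norm_smul, norm_cpow_eq_rpow_re_of_pos hy', sub_re, one_re, Complex.norm_real,
      Real.norm_eq_abs]
    simp only [row, abs_mul, abs_of_pos hy', Nat.abs_cast]
  have h2 := mellin_ofReal_eq (row (fun v ↦ |ψ v|) n) s.re
  have h3 := mellin_row (fun v ↦ |ψ v|) n (s.re : ℂ)
  have h4 := mellin_ofReal_eq (fun v ↦ |ψ v|) (2 * s.re + 2)
  have e1 : (2 * (s.re : ℂ) + 2) = ((2 * s.re + 2 : ℝ) : ℂ) := by push_cast; ring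
  rw [e1, h4, h2] at h3
  have e2 : ((n : ℂ) + 1) ^ (-(((2 * s.re + 2 : ℝ) : ℂ))) =
      ((((n : ℝ) + 1) ^ (-(2 * s.re + 2)) : ℝ) : ℂ) := by
    rw [ofReal_cpow (by positivity)]
    push_cast
    ring_nf
  rw [e2] at h3
  rw [h1]
  exact_mod_cast h3

/-- **Mellin transform of `m_y`** for a continuous `ψ` supported in `[a,b] ⊂ (0,∞)` and `re s > 0`:
`∫₀^∞ m_y(ψ) y^{s−1} dy = 2 ψ̃(2s+2) L(φ, 2s+2)` (rows summed under the integral by absolute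
convergence: `Σ_n φ(n+1)(n+1)^{−2σ−2} < ∞`). [cite: Verjovsky1994, §2 (Mellin transform of m_y = 2 f̃(2s+2) Σ φ(n) n^{−2s−2})] -/
theorem mellin_verjovskyMeasure (hψc : Continuous ψ) (ha : 0 < a) (hψa : ∀ t, ψ t ≠ 0 → a ≤ t)
    (hψb : ∀ t, ψ t ≠ 0 → t ≤ b) {s : ℂ} (hs : 0 < s.re) :
    mellin (fun y ↦ verjovskyMeasure y (fun u ↦ (ψ u : ℂ))) s =
      2 * mellin (fun v ↦ (ψ v : ℂ)) (2 * s + 2) *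
        LSeries (fun n ↦ (n.totient : ℂ)) (2 * s + 2) := by
  set σ : ℝ := s.re with hσ
  set w : ℂ := 2 * s + 2 with hw
  have hwre : 2 < w.re := by simp [hw]; linarith
  set F : ℕ → ℝ → ℂ := fun n y ↦ (y : ℂ) ^ (s - 1) • (row ψ n y : ℂ) with hF
  -- each row is Mellin-integrable (compact support in `(0,∞)`)
  have hF_int : ∀ n, Integrable (F n) (volume.restrict (Ioi 0)) := fun n ↦ by
    have h := mellinConvergent_bump (ψ := row ψ n) (continuous_row hψc n)
      (a := (a / (n + 1)) ^ 2) (b := (max a b / (n + 1)) ^ 2) (by positivity)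
      (fun y hy ↦ sq_le_of_row_ne_zero ha hψa hy)
      (fun y hy ↦ le_sq_of_row_ne_zero ha hψa hψb hy) s
    exact h
  -- the norms are summable
  set J : ℝ := ∫ v in Ioi (0 : ℝ), v ^ (2 * σ + 2 - 1) * |ψ v| with hJ
  have hJ0 : 0 ≤ J := setIntegral_nonneg measurableSet_Ioi fun v hv ↦
    mul_nonneg (Real.rpow_nonneg (le_of_lt hv) _) (abs_nonneg _)
  have hnorm : ∀ n, ∫ y in Ioi (0 : ℝ), ‖F n y‖ =
      ((n + 1).totient : ℝ) * (2 * ((n : ℝ) + 1) ^ (-(2 * σ + 2)) * J) := fun n ↦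
    integral_norm_row ψ n s
  have hF_sum : Summable fun n ↦ ∫ y in Ioi (0 : ℝ), ‖F n y‖ := by
    simp_rw [hnorm]
    have hp : Summable fun n : ℕ ↦ ((n : ℝ) + 1) ^ (-(2 * σ + 1)) := by
      have h := (summable_nat_add_iff 1).2 (Real.summable_nat_rpow.2
        (show -(2 * σ + 1) < -1 by linarith))
      refine h.congr fun n ↦ ?_
      push_cast; ring_nf
    refine Summable.of_nonneg_of_le (fun n ↦ ?_) (fun n ↦ ?_) (hp.mul_left (2 * J))
    · have : 0 ≤ ((n : ℝ) + 1) ^ (-(2 * σ + 2)) := Real.rpow_nonneg (by positivity) _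
      positivity
    · have hn : (0 : ℝ) < (n : ℝ) + 1 := by positivity
      have hφ : ((n + 1).totient : ℝ) ≤ (n : ℝ) + 1 := by exact_mod_cast Nat.totient_le (n + 1)
      have hpow : ((n : ℝ) + 1) * ((n : ℝ) + 1) ^ (-(2 * σ + 2)) = ((n : ℝ) + 1) ^ (-(2 * σ + 1)) := by
        rw [show -(2 * σ + 1) = -(2 * σ + 2) + 1 by ring, Real.rpow_add_one hn.ne']
        ring
      have h0 : 0 ≤ ((n : ℝ) + 1) ^ (-(2 * σ + 2)) := Real.rpow_nonneg hn.le _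
      calc ((n + 1).totient : ℝ) * (2 * ((n : ℝ) + 1) ^ (-(2 * σ + 2)) * J)
          ≤ ((n : ℝ) + 1) * (2 * ((n : ℝ) + 1) ^ (-(2 * σ + 2)) * J) := by gcongr
        _ = 2 * J * ((n : ℝ) + 1) ^ (-(2 * σ + 1)) := by rw [← hpow]; ring
  -- summing under the integral
  have hsum := hasSum_integral_of_summable_integral_norm hF_int hF_sum
  have hlhs : ∫ y in Ioi (0 : ℝ), (∑' n, F n y) =
      mellin (fun y ↦ verjovskyMeasure y (fun u ↦ (ψ u : ℂ))) s := by
    unfold mellin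
    refine setIntegral_congr_fun measurableSet_Ioi fun y _ ↦ ?_
    beta_reduce
    rw [verjovskyMeasure_eq_tsum_row, smul_eq_mul, ← tsum_mul_left]
    simp only [hF, smul_eq_mul]
  have hrow : ∀ n, ∫ y in Ioi (0 : ℝ), F n y =
      ((n + 1).totient : ℂ) * (2 * ((n : ℂ) + 1) ^ (-w) * mellin (fun v ↦ (ψ v : ℂ)) w) :=
    fun n ↦ mellin_row ψ n s
  rw [hlhs] at hsum
  simp_rw [hrow] at hsum
  rw [← hsum.tsum_eq]
  -- the Dirichlet series
  have habs : LSeries.abscissaOfAbsConv (fun n ↦ (n.totient : ℂ)) < w.re := by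
    refine lt_of_le_of_lt
      (LSeries.abscissaOfAbsConv_le_of_le_const_mul_rpow (x := 1) ⟨1, fun n _ ↦ ?_⟩) ?_
    · simp only [Complex.norm_natCast, Real.rpow_one, one_mul]
      exact_mod_cast Nat.totient_le n
    · have : ((1 : ℝ) : EReal) + 1 = ((2 : ℝ) : EReal) := by
        rw [← EReal.coe_one, ← EReal.coe_add]; norm_num
      rw [this]
      exact EReal.coe_lt_coe_iff.mpr hwre
  have hLs : LSeriesSummable (fun n ↦ (n.totient : ℂ)) w :=
    LSeriesSummable_of_abscissaOfAbsConv_lt_re habs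
  have hL : LSeries (fun n ↦ (n.totient : ℂ)) w =
      ∑' n : ℕ, ((n + 1).totient : ℂ) * ((n : ℂ) + 1) ^ (-w) := by
    rw [LSeries, hLs.tsum_eq_zero_add]
    simp only [LSeries.term_zero, zero_add]
    refine tsum_congr fun n ↦ ?_
    rw [LSeries.term_of_ne_zero (Nat.succ_ne_zero n), cpow_neg, div_eq_mul_inv]
    push_cast
    ring
  rw [hL, ← tsum_mul_left]
  refine tsum_congr fun n ↦ ?_
  ring

/-! ### §2. Continuity and eventual vanishing of `y ↦ m_y(f)` -/

/-- `m_y(f) = 0` once `√y ≥ R` where `f = 0` on `[R, ∞)`, `R ≥ 0`.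
[cite: Verjovsky1994, §1 (m_y(f) = 0 for y large)] -/
theorem verjovskyMeasure_eq_zero_of_le {f : ℝ → ℂ} {R : ℝ} (hR : 0 ≤ R)
    (hfR : ∀ s, R ≤ s → f s = 0) {y : ℝ} (hy : R ^ 2 ≤ y) : verjovskyMeasure y f = 0 := by
  unfold verjovskyMeasure
  refine (tsum_congr fun n ↦ ?_).trans tsum_zero
  have h1 : R ≤ Real.sqrt y := by
    rw [show R = Real.sqrt (R ^ 2) by rw [Real.sqrt_sq hR]]
    exact Real.sqrt_le_sqrt hy
  have h2 : Real.sqrt y ≤ Real.sqrt y * (n + 1) := by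
    have : (1 : ℝ) ≤ n + 1 := by
      have : (0 : ℝ) ≤ n := n.cast_nonneg
      linarith
    exact le_mul_of_one_le_right (Real.sqrt_nonneg _) this
  rw [hfR _ (h1.trans h2), mul_zero]

/-- `y ↦ m_y(f)` is continuous on `(0, ∞)` for continuous `f` vanishing on `[R, ∞)` (locally a
fixed finite sum). [cite: Verjovsky1994, §1 (m_y ∈ dual of C_c^r; continuity in y)] -/
theorem continuousOn_verjovskyMeasure {f : ℝ → ℂ} (hf : Continuous f) {R : ℝ}
    (hfR : ∀ s, R ≤ s → f s = 0) : ContinuousOn (fun y ↦ verjovskyMeasure y f) (Ioi 0) := by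
  intro y₀ hy₀
  have hy₀' : (0 : ℝ) < y₀ := hy₀
  have hh : 0 < y₀ / 2 := by positivity
  set l₀ : ℝ := Real.sqrt (y₀ / 2) with hl₀
  have hl₀0 : 0 < l₀ := Real.sqrt_pos.2 hh
  set N : ℕ := ⌈R / l₀⌉₊ with hN
  have hNR : ∀ y, y₀ / 2 < y → R ≤ Real.sqrt y * N := by
    intro y hy
    have h1 : R / l₀ ≤ N := Nat.le_ceil _
    have h2 : R ≤ l₀ * N := by rwa [div_le_iff₀' hl₀0] at h1
    have h3 : l₀ ≤ Real.sqrt y := Real.sqrt_le_sqrt hy.le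
    calc R ≤ l₀ * N := h2
      _ ≤ Real.sqrt y * N := by gcongr
  set G : ℝ → ℂ := fun y ↦ (Real.sqrt y : ℂ) *
    ∑ c ∈ Finset.Ioc 0 N, ((Nat.totient c : ℂ) / c) *
      (((Real.sqrt y * c : ℝ) : ℂ) * f (Real.sqrt y * c)) with hG
  have hGc : Continuous G := by
    refine (continuous_ofReal.comp Real.continuous_sqrt).mul ?_
    refine continuous_finsetSum _ fun c _ ↦ ?_
    refine continuous_const.mul ?_
    exact (continuous_ofReal.comp (Real.continuous_sqrt.mul continuous_const)).mul
      (hf.comp (Real.continuous_sqrt.mul continuous_const))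
  have heq : (fun y ↦ verjovskyMeasure y f) =ᶠ[𝓝 y₀] G := by
    filter_upwards [Ioi_mem_nhds (show y₀ / 2 < y₀ by linarith)] with y hy
    have hy' : 0 < y := hh.trans hy
    exact VerjovskyTheoremA.verjovskyMeasure_eq_mul_sum hfR hy' (hNR y hy)
  exact (hGc.continuousAt.congr_of_eventuallyEq heq).continuousWithinAt

/-! ### §3. The sufficiency halves of Theorem B -/

/-- **Verjovsky's Theorem B 2), first half, for the class `C_c^r`** (p. 604: "if `α` … is such
that, for all functions `f ∈ C_c^r(ℝ*)` one has `m_y(f) = m₀(f) + O(y^{α−ε})` as `y → 0`, for all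
`ε > 0`, then the Riemann zeta-function has no zeroes in the half-plane `Re(s) > 2(1−α)`"),
PROVED for every `0 < α ≤ 1` and every `r : ℕ` (the proof tests the rate on one `C^∞` bump).
[cite: Verjovsky1994, Thm B 2) p. 597 (proof p. 604; classes C_c^r, r ≥ 2, §3 p. 603)] -/
theorem riemannZeta_ne_zero_of_verjovskyRate_of_class (r : ℕ) {α : ℝ} (hα0 : 0 < α)
    (hα1 : α ≤ 1)
    (hrate : ∀ f : ℝ → ℂ, IsVerjovskyTest r f → ∀ ε : ℝ, 0 < ε →
      (fun y : ℝ ↦ verjovskyMeasure y f - verjovskyMean f) =O[𝓝[>] 0]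
        fun y : ℝ ↦ y ^ (α - ε))
    {ρ : ℂ} (hρ : 2 * (1 - α) < ρ.re) : riemannZeta ρ ≠ 0 := by
  by_cases hρ1 : 1 ≤ ρ.re
  · exact riemannZeta_ne_zero_of_one_le_re hρ1
  rw [not_le] at hρ1
  intro hζ
  have hρ0 : 0 ≤ 2 * (1 - α) := by linarith
  have hρre0 : 0 < ρ.re := lt_of_le_of_lt hρ0 hρ
  have hρne1 : ρ ≠ 1 := fun h ↦ by rw [h, one_re] at hρ1; exact lt_irrefl _ hρ1
  -- the point `s₀` with `2 s₀ + 2 = ρ`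
  set s₀ : ℂ := ρ / 2 - 1 with hs₀
  have hs₀re : s₀.re = ρ.re / 2 - 1 := by simp [hs₀]
  have hs₀D : -α < s₀.re := by rw [hs₀re]; linarith
  have h2s₀ : 2 * s₀ + 2 = ρ := by rw [hs₀]; ring
  have h2s₀' : 2 * s₀ + 1 = ρ - 1 := by rw [hs₀]; ring
  -- the bump and the test function
  obtain ⟨ψ, a, b, ha, hψ, -, hψa, hψb, hM⟩ := exists_bump (-ρ)
  rw [neg_neg] at hM
  have hψc : Continuous ψ := hψ.continuous
  set f : ℝ → ℂ := fun u ↦ (ψ u : ℂ) with hfdef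
  have hfc : Continuous f := continuous_ofReal.comp hψc
  have hfzero : ∀ x, x ∉ Icc a b → f x = 0 := by
    intro x hx
    have : ψ x = 0 := by
      by_contra h
      exact hx ⟨hψa x h, hψb x h⟩
    simp [hfdef, this]
  have htest : IsVerjovskyTest r f := by
    refine ⟨?_, ?_, ?_⟩
    · have h1 : ContDiff ℝ ((⊤ : ℕ∞) : WithTop ℕ∞) f := ofRealCLM.contDiff.comp hψ
      exact (contDiff_infty.mp h1) r
    · exact HasCompactSupport.intro isCompact_Icc hfzero
    · have hsub : Function.support f ⊆ Icc a b := fun x hx ↦ by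
        by_contra h
        exact hx (hfzero x h)
      have htsupp : tsupport f ⊆ Icc a b := closure_minimal hsub isClosed_Icc
      exact htsupp.trans fun x hx ↦ (lt_of_lt_of_le ha hx.1 : 0 < x)
  have hO := hrate f htest
  set m₀ : ℂ := verjovskyMean f with hm₀
  set V : ℝ → ℂ := fun y ↦ verjovskyMeasure y f with hV
  -- support bound `R` and the height `Y₁ = R²` beyond which `m_y(f) = 0`
  set R : ℝ := max b 0 + 1 with hR
  have hR0 : 0 < R := by rw [hR]; linarith [le_max_right b 0]
  have hfR : ∀ s, R ≤ s → f s = 0 := by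
    intro s hs
    refine hfzero s fun h ↦ ?_
    have : s ≤ b := h.2
    linarith [le_max_left b 0]
  set Y₁ : ℝ := R ^ 2 with hY₁
  have hY₁pos : 0 < Y₁ := by positivity
  have hVzero : ∀ y, Y₁ ≤ y → V y = 0 := fun y hy ↦
    verjovskyMeasure_eq_zero_of_le hR0.le hfR hy
  have hVcont : ContinuousOn V (Ioi 0) := continuousOn_verjovskyMeasure hfc hfR
  -- `E₀ = V − m₀ 1_{(0, Y₁]}`
  set ind : ℝ → ℂ := Set.indicator (Ioc 0 Y₁) (fun _ ↦ (1 : ℂ)) with hind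
  set E₀ : ℝ → ℂ := fun y ↦ V y - m₀ * ind y with hE₀
  have hVli : LocallyIntegrableOn V (Ioi 0) := hVcont.locallyIntegrableOn measurableSet_Ioi
  have hind_int : IntegrableOn ind (Ioi 0) := by
    rw [hind, IntegrableOn, integrable_indicator_iff measurableSet_Ioc]
    exact integrableOn_const (by simp)
  have hE₀li : LocallyIntegrableOn E₀ (Ioi 0) := by
    have : E₀ = V - fun y ↦ m₀ * ind y := by ext y; simp [hE₀]
    have h' : IntegrableOn (fun y ↦ m₀ * ind y) (Ioi (0 : ℝ)) := hind_int.const_mul m₀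
    rw [this]
    exact hVli.sub h'.locallyIntegrableOn
  have hE₀top : ∀ y, Y₁ < y → E₀ y = 0 := by
    intro y hy
    have : y ∉ Ioc 0 Y₁ := fun h ↦ not_le.mpr hy h.2
    simp [hE₀, hVzero y hy.le, hind, Set.indicator_of_notMem this]
  have hE₀bot : ∀ y ∈ Ioc (0 : ℝ) Y₁, E₀ y = V y - m₀ := by
    intro y hy; simp [hE₀, hind, Set.indicator_of_mem hy]
  -- `P = mellin E₀` is holomorphic on `re s > −α`
  have hP : ∀ s : ℂ, -α < s.re → DifferentiableAt ℂ (mellin E₀) s := by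
    intro s hs
    set ε : ℝ := (s.re + α) / 2 with hε
    have hεpos : 0 < ε := by rw [hε]; linarith
    refine mellin_differentiableAt_of_isBigO_rpow (a := s.re + 1) (b := ε - α) hE₀li ?_
      (by linarith) ?_ ?_
    · refine (isBigO_zero _ _).congr' ?_ EventuallyEq.rfl
      filter_upwards [eventually_gt_atTop Y₁] with y hy
      exact (hE₀top y hy).symm
    · refine (hO ε hεpos).congr' ?_ ?_
      · filter_upwards [Ioc_mem_nhdsGT hY₁pos] with y hy
        exact (hE₀bot y hy).symm
      · filter_upwards with y
        rw [neg_sub]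
    · rw [hε]; linarith
  -- Mellin convergence of `V` for `re s > 0`
  have hVconv : ∀ s : ℂ, 0 < s.re → MellinConvergent V s := by
    intro s hs
    refine mellinConvergent_of_isBigO_rpow (a := s.re + 1) (b := 0) hVli ?_ (by linarith) ?_ ?_
    · refine (isBigO_zero _ _).congr' ?_ EventuallyEq.rfl
      filter_upwards [eventually_ge_atTop Y₁] with y hy
      exact (hVzero y hy).symm
    · have hO' := hO (α / 2) (by linarith)
      have h1 : (fun y : ℝ ↦ y ^ (α - α / 2)) =O[𝓝[>] 0] (fun y : ℝ ↦ y ^ (-(0 : ℝ))) := by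
        refine IsBigO.of_bound 1 ?_
        filter_upwards [Ioo_mem_nhdsGT (zero_lt_one' ℝ)] with y hy
        rw [neg_zero, Real.rpow_zero, one_mul, norm_one,
          Real.norm_of_nonneg (Real.rpow_nonneg hy.1.le _)]
        exact Real.rpow_le_one hy.1.le hy.2.le (by linarith)
      have h2 : (fun _ : ℝ ↦ m₀) =O[𝓝[>] 0] (fun y : ℝ ↦ y ^ (-(0 : ℝ))) := by
        refine IsBigO.of_bound ‖m₀‖ ?_
        filter_upwards with y
        simp
      have := (hO'.trans h1).add h2
      simpa [hV] using this
    · simpa using hs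
  -- the Mellin identity on `re s > 0`
  set Mψ : ℂ → ℂ := mellin (fun v ↦ (ψ v : ℂ)) with hMψ
  set L : ℂ → ℂ := LSeries (fun n ↦ (n.totient : ℂ)) with hLdef
  have hId : ∀ s : ℂ, 0 < s.re → mellin V s = 2 * Mψ (2 * s + 2) * L (2 * s + 2) :=
    fun s hs ↦ mellin_verjovskyMeasure hψc ha hψa hψb hs
  have hLζ : ∀ s : ℂ, 0 < s.re →
      L (2 * s + 2) * riemannZeta (2 * s + 2) = riemannZeta (2 * s + 1) := by
    intro s hs
    have h := LSeries_totient_mul_zeta (w := 2 * s + 2) (by simp; linarith)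
    rw [show 2 * s + 2 - 1 = 2 * s + 1 by ring] at h
    exact h
  -- the split `mellin E₀ s = mellin V s − m₀ Y₁^s / s` on `re s > 0`
  have hsplit : ∀ s : ℂ, 0 < s.re →
      mellin E₀ s = mellin V s - m₀ * ((Y₁ : ℂ) ^ s / s) := by
    intro s hs
    obtain ⟨hi1, hi2⟩ := hasMellin_indicator hY₁pos (w := s) hs
    have hE₀def : E₀ = fun y ↦ V y - (fun y ↦ m₀ • ind y) y := by ext y; simp [hE₀, smul_eq_mul]
    rw [hE₀def, (hasMellin_sub (hVconv s hs) (hi1.const_smul m₀)).2, mellin_const_smul, hi2,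
      smul_eq_mul]
  -- the two analytic functions on `D = {re s > −α}`
  set D : Set ℂ := {s | -α < s.re} with hD
  have hDopen : IsOpen D := isOpen_lt continuous_const continuous_re
  have hDconn : IsPreconnected D := (convex_halfSpace_re_gt (-α)).isPreconnected
  set LHS : ℂ → ℂ := fun s ↦ zetaReg (2 * s + 2) * (s * mellin E₀ s + m₀ * (Y₁ : ℂ) ^ s)
    with hLHS
  set RHS : ℂ → ℂ := fun s ↦ (2 * s + 1) * Mψ (2 * s + 2) * zetaReg (2 * s + 1) with hRHS
  have hMψd : Differentiable ℂ Mψ := differentiable_mellin_bump hψc ha hψa hψb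
  have hLHSd : DifferentiableOn ℂ LHS D := by
    intro s hs
    apply DifferentiableAt.differentiableWithinAt
    have h1 : DifferentiableAt ℂ (fun s ↦ zetaReg (2 * s + 2)) s :=
      (differentiable_zetaReg.comp ((differentiable_id.const_mul (2 : ℂ)).add_const 2)).differentiableAt
    have h2 := hP s hs
    have h3 : DifferentiableAt ℂ (fun s ↦ (Y₁ : ℂ) ^ s) s :=
      differentiableAt_id.const_cpow (Or.inl (by exact_mod_cast hY₁pos.ne'))
    exact h1.mul ((differentiableAt_id.mul h2).add (h3.const_mul m₀))
  have hRHSd : DifferentiableOn ℂ RHS D := by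
    intro s _
    apply DifferentiableAt.differentiableWithinAt
    have h1 : DifferentiableAt ℂ (fun s : ℂ ↦ 2 * s + 1) s :=
      (differentiableAt_id.const_mul (2 : ℂ)).add_const 1
    have h2 : DifferentiableAt ℂ (fun s ↦ Mψ (2 * s + 2)) s :=
      (hMψd.comp ((differentiable_id.const_mul (2 : ℂ)).add_const 2)).differentiableAt
    have h3 : DifferentiableAt ℂ (fun s ↦ zetaReg (2 * s + 1)) s :=
      (differentiable_zetaReg.comp ((differentiable_id.const_mul (2 : ℂ)).add_const 1)).differentiableAt
    exact (h1.mul h2).mul h3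
  -- they agree on `re s > 0`
  have hEq : ∀ s : ℂ, 0 < s.re → LHS s = RHS s := by
    intro s hs
    have hs2 : 2 * s + 2 ≠ 1 := by
      intro h; have := congrArg re h; simp at this; linarith
    have hs1 : 2 * s + 1 ≠ 1 := by
      intro h; have := congrArg re h; simp at this; linarith
    have hsne : s ≠ 0 := by
      intro h; rw [h] at hs; simp at hs
    simp only [hLHS, hRHS]
    rw [zetaReg_of_ne_one hs2, zetaReg_of_ne_one hs1, hsplit s hs, hId s hs, ← hLζ s hs]
    field_simp
    ring
  have hEqOn : EqOn LHS RHS D := by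
    have hA1 : AnalyticOnNhd ℂ LHS D := hLHSd.analyticOnNhd hDopen
    have hA2 : AnalyticOnNhd ℂ RHS D := hRHSd.analyticOnNhd hDopen
    have h2D : (2 : ℂ) ∈ D := by
      show -α < (2 : ℂ).re
      simp; linarith
    refine hA1.eqOn_of_preconnected_of_eventuallyEq hA2 hDconn h2D ?_
    have hmem : {s : ℂ | 0 < s.re} ∈ 𝓝 (2 : ℂ) :=
      (isOpen_lt continuous_const continuous_re).mem_nhds (by simp)
    filter_upwards [hmem] with s hs
    exact hEq s hs
  -- evaluate at `s₀`
  have key := hEqOn (hs₀D : s₀ ∈ D)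
  have hL0 : LHS s₀ = 0 := by
    have : zetaReg (2 * s₀ + 2) = 0 := by
      rw [h2s₀, zetaReg_of_ne_one hρne1, hζ, mul_zero]
    simp only [hLHS]
    rw [this, zero_mul]
  rw [hL0] at key
  have hR : RHS s₀ ≠ 0 := by
    have hZ1 : zetaReg (2 * s₀ + 1) ≠ 0 := by
      rw [h2s₀', zetaReg_of_ne_one (by intro h; have := congrArg re h; simp at this; linarith)]
      refine mul_ne_zero (by intro h; have := congrArg re h; simp at this; linarith) ?_
      intro h0
      obtain ⟨n, hn⟩ := (riemannZeta_eq_zero_iff_of_re_nonpos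
        (by simp only [sub_re, one_re]; linarith)).mp h0
      have := congrArg re hn
      simp at this
      have hn0 : (0 : ℝ) ≤ n := n.cast_nonneg
      linarith
    have hρ1' : (2 * s₀ + 1) ≠ 0 := by
      rw [h2s₀']
      intro h; have := congrArg re h; simp at this; linarith
    have hM' : Mψ (2 * s₀ + 2) ≠ 0 := by rw [h2s₀]; exact hM
    simp only [hRHS]
    exact mul_ne_zero (mul_ne_zero hρ1' hM') hZ1
  exact hR key.symm

/-- **Verjovsky's Theorem B 2), first half** (p. 604), the case `r = 2` of
`riemannZeta_ne_zero_of_verjovskyRate_of_class`: if `0 < α ≤ 1` and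
`m_y(f) − m₀(f) = O(y^{α−ε})` for every `f ∈ C_c²(ℝ₊ˣ)` and every `ε > 0`, then `ζ(s) ≠ 0` for
`re s > 2(1−α)`. [cite: Verjovsky1994, Thm B 2) p. 597 (proof p. 604)] -/
theorem riemannZeta_ne_zero_of_verjovskyRate {α : ℝ} (hα0 : 0 < α) (hα1 : α ≤ 1)
    (hrate : ∀ f : ℝ → ℂ, IsVerjovskyTest 2 f → ∀ ε : ℝ, 0 < ε →
      (fun y : ℝ ↦ verjovskyMeasure y f - verjovskyMean f) =O[𝓝[>] 0]
        fun y : ℝ ↦ y ^ (α - ε))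
    {ρ : ℂ} (hρ : 2 * (1 - α) < ρ.re) : riemannZeta ρ ≠ 0 :=
  riemannZeta_ne_zero_of_verjovskyRate_of_class 2 hα0 hα1 hrate hρ

end VerjovskyCriterion

open VerjovskyCriterion in
/-- **Verjovsky 1994, Theorem B 2) — sufficiency half in the fact's binders**: for
`1/2 < α < 3/4`, the rate `m_y(f) − m₀(f) = O(y^{α−ε})` (all `f ∈ C_c²(ℝ₊ˣ)`, all `ε > 0`)
implies `ζ(s) ≠ 0` for `re s > 2(1−α)`. [cite: Verjovsky1994, Thm B 2) p. 597 (first half, proof p. 604)] -/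
theorem Verjovsky1994_thmB2.mpr_holds {α : ℝ} (hα1 : 1 / 2 < α) (hα2 : α < 3 / 4)
    (hrate : ∀ f : ℝ → ℂ, IsVerjovskyTest 2 f → ∀ ε : ℝ, 0 < ε →
      (fun y : ℝ ↦ verjovskyMeasure y f - verjovskyMean f) =O[𝓝[>] 0]
        fun y : ℝ ↦ y ^ (α - ε)) :
    ∀ s : ℂ, 2 * (1 - α) < s.re → riemannZeta s ≠ 0 :=
  fun _ hs ↦ riemannZeta_ne_zero_of_verjovskyRate (by linarith) (by linarith) hrate hs

open VerjovskyCriterion in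
/-- **Verjovsky 1994, Theorem B 1) — sufficiency half**: if `m_y(f) − m₀(f) = o(y^{3/4−ε})` at
`0⁺` for every `f ∈ C_c²(ℝ₊ˣ)` and every `ε > 0`, then the Riemann Hypothesis holds (`o ⟹ O`,
the case `α = 3/4` of `riemannZeta_ne_zero_of_verjovskyRate` gives `ζ ≠ 0` on `re s > 1/2`, and
`QuasiRH(1/2) ⟺ RH` is the tree's `quasiRiemannHypothesis_one_half_iff_holds`).
[cite: Verjovsky1994, Thm B 1) p. 597 (sufficiency)] -/
theorem Verjovsky1994_thmB1.mpr_holds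
    (h : ∀ f : ℝ → ℂ, IsVerjovskyTest 2 f → ∀ ε : ℝ, 0 < ε →
      (fun y : ℝ ↦ verjovskyMeasure y f - verjovskyMean f) =o[𝓝[>] 0]
        fun y : ℝ ↦ y ^ (3 / 4 - ε)) :
    RiemannHypothesis := by
  have hrate : ∀ f : ℝ → ℂ, IsVerjovskyTest 2 f → ∀ ε : ℝ, 0 < ε →
      (fun y : ℝ ↦ verjovskyMeasure y f - verjovskyMean f) =O[𝓝[>] 0]
        fun y : ℝ ↦ y ^ (3 / 4 - ε) := fun f hf ε hε ↦ (h f hf ε hε).isBigO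
  refine quasiRiemannHypothesis_one_half_iff_holds.1 fun s hs h1 _ ↦ ?_
  exact riemannZeta_ne_zero_of_verjovskyRate (α := 3 / 4) (by norm_num) (by norm_num) hrate
    (by linarith) hs

end Literature.NumberTheory.LFunctions
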